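import Literature.NumberTheory.EllipticCurves.IsogenyGeomEndRingProofs
import Literature.NumberTheory.GaloisRepresentations.AbsGaloisGroupProofs
import HarnessLib

/-!
# Geometric complex multiplication is insensitive to the base field

Topic `NumberTheory/EllipticCurves`; theorem-only `Proofs` companion of the prelude
`Literature.NumberTheory.EllipticCurves.Isogeny` (`WeierstrassCurve.HasCM`: `End_{K̄}(E) ≠ ℤ`,
`WeierstrassCurve.HasRationalCM`: `End_K(E) ≠ ℤ`).  Nothing is defined, no named fact is introduced.

For a Weierstrass curve `W` over a field `K` and an algebraic extension `L/K` the tree carries two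
*different* models of "the" algebraic closure: `K̄ = AlgebraicClosure K` (on whose points
`W.geomPoints = E(K̄)` the ring `W.geomEndRing = End_{K̄}(E)` lives) and `L̄ = AlgebraicClosure L`
(carrying `(W.baseChange L).geomEndRing = End_{L̄}(E_L)`).  They are isomorphic over `K`
(`Literature.NumberTheory.GaloisRepresentations.absClosureEquiv K L : K̄ ≃ₐ[K] L̄`, Milne, *Fields
and Galois Theory*, §7), and along the induced bijection of points `E(K̄) ≃ E_L(L̄)` (Mathlib's
`WeierstrassCurve.Affine.Point.map`) an additive map given by a rational map with
`L̄`-coefficients off a finite set becomes one given by the conjugate rational map with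
`K̄`-coefficients (`WeierstrassCurve.isAlgebraicOn_conj_symm_of_algEquiv`).  Consequently

* `WeierstrassCurve.HasCM.of_baseChange` — **if `E_L` has complex multiplication over `L̄` then `E`
  has complex multiplication over `K̄`** (`End(E)` is a geometric invariant: Silverman, *AEC*,
  III.§4, III.§9 and C.11, where "`E` has CM" always refers to `End_{K̄}(E)`);
* `WeierstrassCurve.not_hasRationalCM_baseChange_of_not_hasCM` — a curve without complex
  multiplication over `K̄` acquires no `L`-rational complex multiplication over any algebraic
  extension `L/K` (`End_L(E_L) ⊆ End_{L̄}(E_L) ≅ End_{K̄}(E) = ℤ`).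

The second statement is the form in which "no complex multiplication" enters the `ℓ`-adic theory
over the division fields `K(E[ℓⁿ])` (Serre, *Abelian ℓ-adic representations and elliptic curves*
(1968), IV.2.1–2.2), e.g. the tree's irreducibility theorem
`Literature.AlgebraicGeometry.Motives.finrank_ne_one_of_stable_of_not_hasRationalCM_of_numberField`
applied to `E_L`.

## References

* [SilvermanAEC2009] J. H. Silverman, *The Arithmetic of Elliptic Curves*, 2nd ed., GTM 106
  (2009), III.§4 (the ring `End(E)`), Remark III.4.3, III.§9, Appendix C §11.
* [Serre1968] J.-P. Serre, *Abelian ℓ-adic representations and elliptic curves*, Benjamin 1968,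
  IV.2.1–2.2 (complex multiplication read over `K̄`, resp. over `K`).
* J. S. Milne, *Fields and Galois Theory*, §7 (uniqueness of algebraic closures). [folklore]

## Design

`noncomputable section`, `open scoped Classical`, one universe `u` (`K L : Type u`, as in the
prelude).  The transport lemma is stated for an arbitrary `K`-isomorphism `ι : K̄ ≃ₐ[K] L̄` and an
arbitrary additive isomorphism of points agreeing with `Affine.Point.map ι` (pattern of the tree's
`WeierstrassCurve.isAlgebraicOn_conj`, `IsogenyGeomEndRingCommProofs`); the identification of the
point groups uses that `(W.baseChange L).baseChange L̄ = W.baseChange L̄` holds definitionally for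
Mathlib's tower algebra structure on `AlgebraicClosure L`.
-/

noncomputable section

open scoped Classical

universe u

namespace WeierstrassCurve

open Literature.NumberTheory.GaloisRepresentations

/-! ## Evaluation of two-variable polynomials along a ring homomorphism -/

/-- Evaluation of a two-variable polynomial commutes with a ring homomorphism applied to the
coefficients and to the arguments. [folklore] -/
theorem eval_map_ringHom_fin_two {A B : Type*} [CommRing A] [CommRing B] (φ : A →+* B)
    (p : MvPolynomial (Fin 2) A) (x y : A) :
    MvPolynomial.eval ![φ x, φ y] (MvPolynomial.map φ p) = φ (MvPolynomial.eval ![x, y] p) := by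
  rw [MvPolynomial.eval_map,
    show MvPolynomial.eval ![x, y] p = MvPolynomial.eval₂ (RingHom.id _) ![x, y] p from rfl,
    MvPolynomial.eval₂_comp_left, RingHom.comp_id]
  congr 1
  funext i
  fin_cases i <;> rfl

/-! ## Transport of algebraic maps along `K̄ ≃ L̄` -/

section Transport

variable {K : Type u} [Field K] {W : WeierstrassCurve K} {L : Type u} [Field L] [Algebra K L]

/-- **An algebraic additive map of `E_L(L̄)`, conjugated back to `E(K̄)` along `K̄ ≃ L̄`, is
algebraic.**  Let `ι : K̄ ≃ₐ[K] L̄` be a `K`-isomorphism of algebraic closures and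
`e : E(K̄) ≃+ E_L(L̄)` an additive isomorphism which is `Affine.Point.map ι` on points
(`(x, y) ↦ (ι x, ι y)`).  If `f : E_L(L̄) → E_L(L̄)` agrees off a finite set with the rational map
`(P₁/Q₁, P₂/Q₂)`, `Pᵢ, Qᵢ ∈ L̄[x, y]`, then `e⁻¹ ∘ f ∘ e` agrees off a finite set with
`(P₁^ψ/Q₁^ψ, P₂^ψ/Q₂^ψ)`, `ψ = ι⁻¹` applied to the coefficients.  Silverman, *AEC*, III.§4
(`End(E)` is attached to `E/K̄`). [folklore] -/
theorem isAlgebraicOn_conj_symm_of_algEquiv (ι : AlgebraicClosure K ≃ₐ[K] AlgebraicClosure L)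
    (e : W.geomPoints ≃+ (W.baseChange L).geomPoints)
    (he : ∀ P, e P = Affine.Point.map (W' := W)
      (ι : AlgebraicClosure K →ₐ[K] AlgebraicClosure L) P)
    {f : (W.baseChange L).geomPoints →+ (W.baseChange L).geomPoints}
    (hf : IsAlgebraicOn (W.baseChange L) (W.baseChange L) f) :
    IsAlgebraicOn W W ((e.symm.toAddMonoidHom.comp f).comp e.toAddMonoidHom) := by
  set φ : AlgebraicClosure K →+* AlgebraicClosure L :=
    (ι : AlgebraicClosure K →+* AlgebraicClosure L) with hφ
  set ψ : AlgebraicClosure L →+* AlgebraicClosure K :=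
    (ι.symm : AlgebraicClosure L →+* AlgebraicClosure K) with hψ
  have hφx : ∀ x, φ x = ι x := fun _ ↦ rfl
  have hιψ : ∀ y, ι (ψ y) = y := fun y ↦ ι.apply_symm_apply y
  -- `(q^ψ)^ι = q`
  have hmap : ∀ q : MvPolynomial (Fin 2) (AlgebraicClosure L), (q.map ψ).map φ = q := fun q ↦ by
    rw [MvPolynomial.map_map]
    have hc : φ.comp ψ = RingHom.id _ := RingHom.ext fun y ↦ hιψ y
    rw [hc, MvPolynomial.map_id]
  -- evaluation at `(ι x, ι y)` of `q` is `ι` of the evaluation of `q^ψ` at `(x, y)`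
  have heval : ∀ (q : MvPolynomial (Fin 2) (AlgebraicClosure L)) (x y : AlgebraicClosure K),
      MvPolynomial.eval ![ι x, ι y] q = ι (MvPolynomial.eval ![x, y] (q.map ψ)) := fun q x y ↦ by
    conv_lhs => rw [← hmap q, ← hφx x, ← hφx y]
    exact eval_map_ringHom_fin_two φ (q.map ψ) x y
  obtain ⟨P₁, Q₁, P₂, Q₂, hfin⟩ := hf
  refine ⟨P₁.map ψ, Q₁.map ψ, P₂.map ψ, Q₂.map ψ, ?_⟩
  refine (hfin.image e.symm).subset fun P hP ↦ ?_
  refine ⟨e P, fun hP' ↦ hP ?_, e.symm_apply_apply P⟩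
  -- transport the agreement of `f` at `e P` back to `P`
  obtain ⟨x', y', h', hePeq, hQ₁, hQ₂, h'', hfP⟩ := hP'
  cases P with
  | zero =>
    exact absurd ((map_zero e).symm.trans hePeq) (Affine.Point.some_ne_zero _).symm
  | some x y h =>
    rw [he, Affine.Point.map_some] at hePeq
    obtain ⟨rfl, rfl⟩ := Affine.Point.some.inj hePeq
    -- the affine coordinates of `f (e P)`, read back in `K̄`
    set a : AlgebraicClosure K :=
      MvPolynomial.eval ![x, y] (P₁.map ψ) / MvPolynomial.eval ![x, y] (Q₁.map ψ) with ha
    set b : AlgebraicClosure K :=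
      MvPolynomial.eval ![x, y] (P₂.map ψ) / MvPolynomial.eval ![x, y] (Q₂.map ψ) with hb
    have hx' : MvPolynomial.eval ![(ι : AlgebraicClosure K →ₐ[K] AlgebraicClosure L) x,
          (ι : AlgebraicClosure K →ₐ[K] AlgebraicClosure L) y] P₁ /
        MvPolynomial.eval ![(ι : AlgebraicClosure K →ₐ[K] AlgebraicClosure L) x,
          (ι : AlgebraicClosure K →ₐ[K] AlgebraicClosure L) y] Q₁ = ι a := by
      change MvPolynomial.eval ![ι x, ι y] P₁ / MvPolynomial.eval ![ι x, ι y] Q₁ = ι a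
      rw [heval, heval, ha, map_div₀]
    have hy' : MvPolynomial.eval ![(ι : AlgebraicClosure K →ₐ[K] AlgebraicClosure L) x,
          (ι : AlgebraicClosure K →ₐ[K] AlgebraicClosure L) y] P₂ /
        MvPolynomial.eval ![(ι : AlgebraicClosure K →ₐ[K] AlgebraicClosure L) x,
          (ι : AlgebraicClosure K →ₐ[K] AlgebraicClosure L) y] Q₂ = ι b := by
      change MvPolynomial.eval ![ι x, ι y] P₂ / MvPolynomial.eval ![ι x, ι y] Q₂ = ι b
      rw [heval, heval, hb, map_div₀]
    -- `(a, b)` is a nonsingular point of `E(K̄)` since `(ι a, ι b) = f (e P)` is one of `E_L(L̄)`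
    have h3 : ((W.baseChange L).baseChange (AlgebraicClosure L)).toAffine.Nonsingular (ι a) (ι b) := by
      rw [← hx', ← hy']
      exact h''
    have hab : (W.baseChange (AlgebraicClosure K)).toAffine.Nonsingular a b :=
      (Affine.baseChange_nonsingular (W := W)
        (f := (ι : AlgebraicClosure K →ₐ[K] AlgebraicClosure L)) ι.injective a b).mp h3
    have h4 : e (.some a b hab) = .some (ι a) (ι b) h3 := by
      rw [he]
      rfl
    have key : f (e (.some x y h)) = e (.some a b hab) := by
      rw [hfP, h4]
      exact Affine.Point.some.congr_simp _ _ hx' _ _ hy' _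
    refine ⟨x, y, h, rfl, ?_, ?_, hab, ?_⟩
    · have hq : MvPolynomial.eval ![ι x, ι y] Q₁ ≠ 0 := hQ₁
      rw [heval] at hq
      exact (_root_.map_ne_zero ι).mp hq
    · have hq : MvPolynomial.eval ![ι x, ι y] Q₂ ≠ 0 := hQ₂
      rw [heval] at hq
      exact (_root_.map_ne_zero ι).mp hq
    · change e.symm (f (e (.some x y h))) = _
      rw [key, e.symm_apply_apply]

end Transport

/-! ## Complex multiplication over `K̄` and base change -/

section HasCM

variable {K : Type u} [Field K] (W : WeierstrassCurve K) (L : Type u) [Field L] [Algebra K L]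

/-- The base change of points `E(K̄) → E_L(L̄)` along a `K`-isomorphism `ι : K̄ ≃ L̄` is onto.
[folklore] -/
theorem map_algEquiv_algebraicClosure_surjective
    (ι : AlgebraicClosure K ≃ₐ[K] AlgebraicClosure L) :
    Function.Surjective (Affine.Point.map (W' := W)
      (ι : AlgebraicClosure K →ₐ[K] AlgebraicClosure L) :
        W.geomPoints → (W.baseChange L).geomPoints) := by
  intro Q
  cases Q with
  | zero => exact ⟨0, rfl⟩
  | some u w hQ =>
    obtain ⟨x, rfl⟩ := ι.surjective u
    obtain ⟨y, rfl⟩ := ι.surjective w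
    exact ⟨.some x y ((Affine.baseChange_nonsingular (W := W)
      (f := (ι : AlgebraicClosure K →ₐ[K] AlgebraicClosure L)) ι.injective x y).mp hQ), rfl⟩

variable {W L} in
/-- **Complex multiplication over `K̄` does not depend on the base field.**  For an elliptic curve
`E = W` over a field `K` and an algebraic extension `L/K`: if the base change `E_L` has complex
multiplication over `L̄` (`(W.baseChange L).HasCM`), then `E` has complex multiplication over `K̄`
(`W.HasCM`).  A non-scalar `φ ∈ End_{L̄}(E_L)` is an algebraic additive map (the tree's
`mem_geomEndRing_iff_holds`, Silverman III.4); conjugated along `E(K̄) ≃ E_L(L̄)` (induced by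
`K̄ ≃ₐ[K] L̄`, `absClosureEquiv`) it is an algebraic additive map of `E(K̄)`
(`isAlgebraicOn_conj_symm_of_algEquiv`), i.e. an element of `End_{K̄}(E)`, and it is not `[n]`
because conjugation fixes every `[n]`.  Silverman, *AEC*, III.§4 and C.11 (complex multiplication
is a property of `E` over `K̄`). [cite: SilvermanAEC2009, III.§4 (the ring End(E)) and Remark III.4.3] -/
theorem HasCM.of_baseChange [W.IsElliptic] [Algebra.IsAlgebraic K L]
    (hCM : (W.baseChange L).HasCM) : W.HasCM := by
  obtain ⟨φ, hφ, hn⟩ := hCM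
  set ι : AlgebraicClosure K ≃ₐ[K] AlgebraicClosure L := absClosureEquiv K L with hι
  -- the bijection of points `e : E(K̄) ≃+ E_L(L̄)` along `ι`
  let e : W.geomPoints ≃+ (W.baseChange L).geomPoints :=
    AddEquiv.ofBijective
      (Affine.Point.map (W' := W) (ι : AlgebraicClosure K →ₐ[K] AlgebraicClosure L) :
        W.geomPoints →+ (W.baseChange L).geomPoints)
      ⟨Affine.Point.map_injective (W' := W) _, map_algEquiv_algebraicClosure_surjective W L ι⟩
  have he : ∀ P, e P = Affine.Point.map (W' := W)
      (ι : AlgebraicClosure K →ₐ[K] AlgebraicClosure L) P := fun _ ↦ rfl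
  -- `φ` is algebraic, hence so is its conjugate `ψ = e⁻¹ ∘ φ ∘ e`
  have hφ0 : φ ≠ 0 := fun h0 ↦ hn 0 (by rw [h0, Int.cast_zero])
  have halg : IsAlgebraicOn (W.baseChange L) (W.baseChange L) φ :=
    ((mem_geomEndRing_iff_holds (W := W.baseChange L) φ).1 hφ).resolve_left hφ0
  let ψ : AddMonoid.End W.geomPoints :=
    (e.symm.toAddMonoidHom.comp (φ : (W.baseChange L).geomPoints →+ (W.baseChange L).geomPoints)).comp
      e.toAddMonoidHom
  have hψ_apply : ∀ P, ψ P = e.symm (φ (e P)) := fun _ ↦ rfl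
  have hψalg : IsAlgebraicOn W W ψ := isAlgebraicOn_conj_symm_of_algEquiv ι e he halg
  refine ⟨ψ, Subring.subset_closure hψalg, fun n hψn ↦ hn n ?_⟩
  -- if `e⁻¹ φ e = [n]` then `φ = e [n] e⁻¹ = [n]`
  have hψn' : ∀ m, ψ m = n • m := fun m ↦
    (AddMonoid.End.ext_iff.1 hψn m).trans (AddMonoid.End.intCast_apply n m)
  refine AddMonoid.End.ext_iff.2 fun Q ↦ ?_
  have hQ : e.symm (φ Q) = n • e.symm Q := by
    have h := hψn' (e.symm Q)
    rwa [hψ_apply, AddEquiv.apply_symm_apply] at h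
  calc φ Q = e (e.symm (φ Q)) := (e.apply_symm_apply _).symm
    _ = e (n • e.symm Q) := by rw [hQ]
    _ = n • Q := by rw [map_zsmul, AddEquiv.apply_symm_apply]
    _ = (n : AddMonoid.End (W.baseChange L).geomPoints) Q := (AddMonoid.End.intCast_apply n Q).symm

variable {W} in
/-- **No complex multiplication over `K̄` ⇒ no `L`-rational complex multiplication of `E_L`**, for
every algebraic extension `L/K`: `End_L(E_L) ⊆ End_{L̄}(E_L)` (`HasRationalCM.hasCM`) and
`HasCM.of_baseChange`.  This is how "`E` has no complex multiplication" is used over the division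
fields `K(E[ℓⁿ])` in Serre (1968), IV.2.1–2.2. [cite: SilvermanAEC2009, III.§4 and Remark III.4.3]
[cite: Serre1968, Ch. IV §2.1] -/
theorem not_hasRationalCM_baseChange_of_not_hasCM [W.IsElliptic] [Algebra.IsAlgebraic K L]
    (hCM : ¬ W.HasCM) : ¬ (W.baseChange L).HasRationalCM :=
  fun h ↦ hCM (HasCM.of_baseChange h.hasCM)

variable {W} in
/-- `¬ HasCM` form: a curve without complex multiplication over `K̄` has none over `L̄` after base
change to an algebraic extension `L/K`. [cite: SilvermanAEC2009, III.§4 and Remark III.4.3] -/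
theorem not_hasCM_baseChange_of_not_hasCM [W.IsElliptic] [Algebra.IsAlgebraic K L]
    (hCM : ¬ W.HasCM) : ¬ (W.baseChange L).HasCM :=
  fun h ↦ hCM (HasCM.of_baseChange h)

end HasCM

end WeierstrassCurve
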